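import Summits.Ventures.LatticeQCDFlow.Scoring.NonabelianAreaLaw2DPuncture
import HarnessLib

/-!
# The exact non-abelian area law in two dimensions, V-a: peeling the punctured TORUS around a rectangle

HONEST FRAMING: exact (Metropolis-corrected) sampling algorithms for lattice gauge theory;
figures of merit are autocorrelation/cost numbers at stated couplings and volumes; no
continuum-physics claim.

Venture `LatticeQCDFlow` (cell pub-lqcd), sub-topic `Scoring`; FANOUT row 5 (`s0-sun-a`), GEN-18.
NEW WORK of the cell (placement rule); the tool behind the TORUS area law of part V-b (theory-2 /
`Literature…ConstructiveQFTWave0.HasAreaLaw` in `d = 2`).  On the torus `(ℤ/L)²` no plaquette has a private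
link, but off ONE puncture `x₀` the plaquettes outside a rectangle `Reg = {(i'+a, j'+b) : a < R, b < T}`
(`R + 1 ≤ L`, `T + 1 ≤ L`) can be integrated out one by one, for EVERY compact second-countable gauge group:

* **`integral_mul_prod_punctured_eq`** — for every finite set `t` of plaquettes outside `Reg` with `x₀ ∉ t`,
  every continuous weight `v` and every continuous `Φ` that ignores all links belonging to no plaquette of
  `Reg` (e.g. `Φ = ρ(W_{∂Reg})_{ab} · ∏_{p∈Reg} w(U_p)`):
  `∫ Φ · ∏_{x∈t} v(U_x) dHaar^{⊗E} = (∫ v dHaar)^{#t} · ∫ Φ dHaar^{⊗E}`.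
  Order of peeling (no definition is introduced; the rank lives inside the proof): relative to the region's
  corner and the puncture, a plaquette on the puncture's column above the puncture is peeled through its
  BOTTOM link, a plaquette on the row `j' − 1` through its RIGHT link, any other plaquette through its TOP
  link; along these links the rank strictly decreases towards `x₀`, and the partner plaquette of the link is
  never in `Reg` — so at its turn each plaquette owns its link (part I, one-link peeling).
* **`integral_rep_loop_mul_prod_punctured`** — with part II: for the `R × T` loop `W` along `∂Reg`,
  `∫ ρ(W)_{ab} ∏_{p∈Reg} w(U_p) ∏_{x∈t} v(U_x) dHaar^{⊗E} = (∫ v)^{#t} (M_w^{RT})_{ab}` — the torus analogue of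
  part IV-c, exact as long as one outside plaquette carries no weight.

No `def`, nothing cited as a fact, 0 sorry.
-/

noncomputable section

open MeasureTheory Function Finset
open Literature.MathematicalPhysics.QuantumFieldTheory
open Literature.MathematicalPhysics.QuantumLattice
open Summit.Ventures.LatticeQCDFlow.Theory2.Lattice
open Summit.Ventures.LatticeQCDFlow.Theory2.Lattice.TwoDim

namespace Summit.Ventures.LatticeQCDFlow.Scoring

variable {L : ℕ} [NeZero L] {G : Type*} [Group G] [TopologicalSpace G] [IsTopologicalGroup G]
  [CompactSpace G] [SecondCountableTopology G] [MeasurableSpace G] [BorelSpace G]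

/-! ## §3. Peeling the punctured torus around a rectangle -/

section Punctured

/-- **PEELING THE PUNCTURED TORUS AROUND A RECTANGLE.**  On `(ℤ/L)²` (`L ≥ 2`) let
`Reg = {(i'+a, j'+b) : a < R, b < T}` with `R + 1 ≤ L`, `T + 1 ≤ L`, let `x₀ ∉ Reg` (the puncture), `t` a
finite set of plaquettes outside `Reg` with `x₀ ∉ t`, `v` a continuous weight and `Φ` a continuous function of
the links that ignores every link belonging to no plaquette of `Reg`.  Then
`∫ Φ · ∏_{x∈t} v(U_x) dHaar^{⊗E} = (∫ v dHaar)^{#t} · ∫ Φ dHaar^{⊗E}`. -/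
theorem integral_mul_prod_punctured_eq (hL : 2 ≤ L) (i' j' : ZMod L) {R T : ℕ} (hR : R + 1 ≤ L)
    (hT : T + 1 ≤ L) (x₀ : Site 2 L)
    (hx₀ : x₀ ∉ (range R ×ˢ range T).image (fun q : ℕ × ℕ => (![i' + q.1, j' + q.2] : Site 2 L)))
    {v : G → ℝ} (hv : Continuous v) {Φ : GaugeConfig 2 L G → ℂ} (hΦ : Continuous Φ)
    (hΦe : ∀ (e : Edge 2 L) (U : GaugeConfig 2 L G) (g : G),
      (∀ p ∈ (range R ×ˢ range T).image (fun q : ℕ × ℕ => (![i' + q.1, j' + q.2] : Site 2 L)),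
        ((p, 0) : Edge 2 L) ≠ e ∧ ((Site.shift p 0, 1) : Edge 2 L) ≠ e ∧
          ((Site.shift p 1, 0) : Edge 2 L) ≠ e ∧ ((p, 1) : Edge 2 L) ≠ e) → Φ (update U e g) = Φ U)
    (t : Finset (Site 2 L))
    (ht : ∀ x ∈ t, x ∉ (range R ×ˢ range T).image (fun q : ℕ × ℕ => (![i' + q.1, j' + q.2] : Site 2 L)))
    (hx₀t : x₀ ∉ t) :
    ∫ U, Φ U * ∏ x ∈ t, (v (plaquetteHolonomy U x 0 1) : ℂ) ∂(Measure.pi fun _ : Edge 2 L => haarProbability G) =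
      (∫ g, (v g : ℂ) ∂(haarProbability G)) ^ t.card *
        ∫ U, Φ U ∂(Measure.pi fun _ : Edge 2 L => haarProbability G) := by
  classical
  haveI : Fact (1 < L) := ⟨hL⟩
  have hmem : ∀ x : Site 2 L,
      x ∈ (range R ×ˢ range T).image (fun q : ℕ × ℕ => (![i' + q.1, j' + q.2] : Site 2 L)) ↔
        (x 0 - i').val < R ∧ (x 1 - j').val < T := mem_rect_iff i' j' (by omega) (by omega)
  have hev : ∀ e' : Edge 2 L, Continuous fun U : GaugeConfig 2 L G => U e' := fun e' => continuous_apply e'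
  have h01 : ((0 : Fin 2)) ≠ 1 := by decide
  -- the puncture in coordinates
  have hx₀' : ¬((x₀ 0 - i').val < R ∧ (x₀ 1 - j').val < T) := fun h => hx₀ ((hmem x₀).mpr h)
  revert ht hx₀t
  refine Finset.induction_on_min_value (fun x : Site 2 L =>
    if x 0 = x₀ 0 ∧ (x₀ 1 - j').val < (x 1 - j').val then (x 1 - j').val - (x₀ 1 - j').val
    else if (x 1 - j').val = L - 1 then L + (x₀ 0 - x 0).val
    else 2 * L + (L - 1 - (x 1 - j').val)) t ?_ ?_
  · intro _ _; simp
  · intro q s hqs hmin ih hins hx₀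
    have hq : ¬((q 0 - i').val < R ∧ (q 1 - j').val < T) := fun h =>
      hins q (mem_insert_self q s) ((hmem q).mpr h)
    have hs : ∀ x ∈ s, x ∉ (range R ×ˢ range T).image (fun q : ℕ × ℕ => (![i' + q.1, j' + q.2] : Site 2 L)) :=
      fun x hx => hins x (mem_insert_of_mem hx)
    have hqx₀ : q ≠ x₀ := fun h => hx₀ (h ▸ mem_insert_self q s)
    have hx₀s : x₀ ∉ s := fun h => hx₀ (mem_insert_of_mem h)
    have hvalL : ∀ z : ZMod L, z.val < L := fun z => ZMod.val_lt z
    -- `b`-coordinates of the two vertical neighbours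
    have hb_up : ∀ x : Site 2 L, (x 1 - j').val ≠ L - 1 → ((x.shift 1) 1 - j').val = (x 1 - j').val + 1 := by
      intro x hx
      rw [(shift_one_apply x).2, show x 1 + 1 - j' = (x 1 - j') + 1 by ring]
      exact val_add_one_eq hL hx
    -- it suffices to peel `q`
    suffices hpeel : ∫ U, Φ U * ∏ x ∈ insert q s, (v (plaquetteHolonomy U x 0 1) : ℂ)
          ∂(Measure.pi fun _ : Edge 2 L => haarProbability G) =
        (∫ g, (v g : ℂ) ∂(haarProbability G)) *
          ∫ U, Φ U * ∏ x ∈ s, (v (plaquetteHolonomy U x 0 1) : ℂ)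
            ∂(Measure.pi fun _ : Edge 2 L => haarProbability G) by
      rw [hpeel, ih hs hx₀s, Finset.card_insert_of_notMem hqs, pow_succ]
      ring
    by_cases hA : q 0 = x₀ 0 ∧ (x₀ 1 - j').val < (q 1 - j').val
    · -- Case A: `q` on the puncture's column above the puncture — peel through the BOTTOM link `(q, 0)`;
      -- its partner is `q − e₁` (smaller rank, or the puncture), never in `Reg`
      have hrank_q : (fun x : Site 2 L =>
          if x 0 = x₀ 0 ∧ (x₀ 1 - j').val < (x 1 - j').val then (x 1 - j').val - (x₀ 1 - j').val
          else if (x 1 - j').val = L - 1 then L + (x₀ 0 - x 0).val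
          else 2 * L + (L - 1 - (x 1 - j').val)) q = (q 1 - j').val - (x₀ 1 - j').val := by
        simp only [if_pos hA]
      -- the partner: any `y` with `y + e₁ = q`
      have hpartner : ∀ y : Site 2 L, y.shift 1 = q →
          y 0 = x₀ 0 ∧ (y 1 - j').val + 1 = (q 1 - j').val := by
        intro y hy
        have h0 : y 0 = q 0 := by rw [← (shift_one_apply y).1, hy]
        refine ⟨h0.trans hA.1, ?_⟩
        by_cases hy1 : (y 1 - j').val = L - 1
        · exfalso
          have h2 : ((y.shift 1) 1 - j').val = 0 := by
            rw [(shift_one_apply y).2, show y 1 + 1 - j' = (y 1 - j') + 1 by ring, ZMod.val_add, ZMod.val_one,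
              hy1, Nat.sub_add_cancel (by omega), Nat.mod_self]
          rw [hy] at h2
          have := hA.2
          omega
        · rw [← hb_up y hy1, hy]
      have hnot_s : ∀ y ∈ s, y.shift 1 ≠ q := by
        intro y hy hyq
        obtain ⟨h0, hb⟩ := hpartner y hyq
        have hm := hmin y hy
        simp only [hrank_q] at hm
        by_cases hlt : (x₀ 1 - j').val < (y 1 - j').val
        · rw [if_pos ⟨h0, hlt⟩] at hm
          omega
        · -- then `y = x₀`
          have hyb : (y 1 - j').val = (x₀ 1 - j').val := by have := hA.2; omega
          have hy0 : y = x₀ := by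
            rw [site_eq_iff]
            refine ⟨h0, ?_⟩
            have := ZMod.val_injective L hyb
            exact sub_left_injective this
          exact hx₀s (hy0 ▸ hy)
      have hnot_reg : ∀ p ∈ (range R ×ˢ range T).image (fun q : ℕ × ℕ => (![i' + q.1, j' + q.2] : Site 2 L)),
          Site.shift p 1 ≠ q := by
        intro p hp hpq
        obtain ⟨h0, hb⟩ := hpartner p hpq
        have hp' := (hmem p).mp hp
        have ha : (p 0 - i').val = (x₀ 0 - i').val := by rw [h0]
        have := hA.2
        omega
      refine integral_mul_prod_insert_peel hv hΦ hqs ((q, 0) : Edge 2 L) (A := fun _ => 1)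
        (B := fun U => U (q.shift 0, 1) * (U (q.shift 1, 0))⁻¹ * (U (q, 1))⁻¹) continuous_const
        (((hev _).mul (hev _).inv).mul (hev _).inv) (fun _ _ => rfl) (fun U g => ?_) (fun U => ?_)
        (fun U g => hΦe _ U g fun p hp => ⟨?_, ?_, ?_, ?_⟩) (fun x hx U g => ?_)
      · show update U (q, 0) g (q.shift 0, 1) * (update U (q, 0) g (q.shift 1, 0))⁻¹ *
            (update U (q, 0) g (q, 1))⁻¹ = _
        rw [update_of_ne (fun h => h01.symm (congrArg Prod.snd h)),
          update_of_ne (fun h => shift_ne_self hL q 1 (congrArg Prod.fst h)),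
          update_of_ne (fun h => h01.symm (congrArg Prod.snd h))]
      · unfold plaquetteHolonomy; simp only [one_mul, mul_assoc]
      · exact fun h => (hins q (mem_insert_self q s)) (by
          have h' : p = q := congrArg Prod.fst h
          exact h' ▸ hp)
      · exact fun h => h01.symm (congrArg Prod.snd h)
      · exact fun h => hnot_reg p hp (congrArg Prod.fst h)
      · exact fun h => h01.symm (congrArg Prod.snd h)
      · exact plaquetteHolonomy_update_horiz g (fun h => hqs (h ▸ hx)) (hnot_s x hx)
    · by_cases hB : (q 1 - j').val = L - 1
      · -- Case B: `q` on the row `j' − 1` — peel through the RIGHT link `(q + e₀, 1)`; partner `q + e₀`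
        have hrank_q : (fun x : Site 2 L =>
            if x 0 = x₀ 0 ∧ (x₀ 1 - j').val < (x 1 - j').val then (x 1 - j').val - (x₀ 1 - j').val
            else if (x 1 - j').val = L - 1 then L + (x₀ 0 - x 0).val
            else 2 * L + (L - 1 - (x 1 - j').val)) q = L + (x₀ 0 - q 0).val := by
          simp only [if_neg hA, if_pos hB]
        have hq0 : q 0 ≠ x₀ 0 := by
          intro h0
          have hb0 : (x₀ 1 - j').val = L - 1 := by
            have := hvalL (x₀ 1 - j')
            by_contra hne
            exact hA ⟨h0, by omega⟩
          apply hqx₀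
          rw [site_eq_iff]
          exact ⟨h0, sub_left_injective (ZMod.val_injective L (hB.trans hb0.symm))⟩
        have hz : x₀ 0 - q 0 ≠ 0 := fun h => hq0 (sub_eq_zero.mp h).symm
        have hnot_s : q.shift 0 ∉ s := by
          intro hy
          have hm := hmin _ hy
          simp only [hrank_q] at hm
          have hy0 : (q.shift 0) 0 = q 0 + 1 := (shift_zero_apply q).1
          have hy1 : (q.shift 0) 1 = q 1 := (shift_zero_apply q).2
          rw [hy0, hy1] at hm
          by_cases h1 : q 0 + 1 = x₀ 0 ∧ (x₀ 1 - j').val < (q 1 - j').val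
          · rw [if_pos h1] at hm
            have := hvalL (q 1 - j')
            omega
          · rw [if_neg h1, if_pos hB] at hm
            by_cases h2 : q 0 + 1 = x₀ 0
            · -- then `q + e₀ = x₀`
              have hb0 : (x₀ 1 - j').val = L - 1 := by
                have := hvalL (x₀ 1 - j')
                by_contra hne
                exact h1 ⟨h2, by omega⟩
              apply hx₀s
              have : q.shift 0 = x₀ := by
                rw [site_eq_iff, hy0, hy1]
                exact ⟨h2, sub_left_injective (ZMod.val_injective L (hB.trans hb0.symm))⟩
              exact this ▸ hy
            · have h3 : (x₀ 0 - (q 0 + 1)).val = (x₀ 0 - q 0).val - 1 := by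
                rw [show x₀ 0 - (q 0 + 1) = (x₀ 0 - q 0) - 1 by ring]
                exact val_sub_one_eq hL hz
              rw [h3] at hm
              have : (x₀ 0 - q 0).val ≠ 0 := fun h => hz ((ZMod.val_eq_zero _).mp h)
              omega
        have hnot_reg : q.shift 0 ∉
            (range R ×ˢ range T).image (fun q : ℕ × ℕ => (![i' + q.1, j' + q.2] : Site 2 L)) := by
          intro hp
          have hp' := (hmem _).mp hp
          rw [(shift_zero_apply q).2] at hp'
          omega
        refine integral_mul_prod_insert_peel hv hΦ hqs ((q.shift 0, 1) : Edge 2 L) (A := fun U => U (q, 0))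
          (B := fun U => (U (q.shift 1, 0))⁻¹ * (U (q, 1))⁻¹) (hev _) ((hev _).inv.mul (hev _).inv)
          (fun U g => ?_) (fun U g => ?_) (fun U => ?_)
          (fun U g => hΦe _ U g fun p hp => ⟨?_, ?_, ?_, ?_⟩) (fun x hx U g => ?_)
        · exact update_of_ne (fun h => h01 (congrArg Prod.snd h)) _ _
        · show (update U (q.shift 0, 1) g (q.shift 1, 0))⁻¹ * (update U (q.shift 0, 1) g (q, 1))⁻¹ = _
          rw [update_of_ne (fun h => h01 (congrArg Prod.snd h)),
            update_of_ne (fun h => shift_ne_self hL q 0 (congrArg Prod.fst h).symm)]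
        · unfold plaquetteHolonomy; simp only [mul_assoc]
        · exact fun h => h01 (congrArg Prod.snd h)
        · exact fun h => (hins q (mem_insert_self q s)) (by
            have h' : p = q := add_right_cancel (congrArg Prod.fst h :)
            exact h' ▸ hp)
        · exact fun h => h01 (congrArg Prod.snd h)
        · exact fun h => hnot_reg (by
            have h' : p = q.shift 0 := congrArg Prod.fst h
            exact h' ▸ hp)
        · exact plaquetteHolonomy_update_vert g (fun h => hnot_s (h ▸ hx))
            (fun h => hqs ((add_right_cancel h : x = q) ▸ hx))
      · -- Case C: any other outside plaquette — peel through the TOP link `(q + e₁, 0)`, inverted;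
        -- partner `q + e₁`
        have hrank_q : (fun x : Site 2 L =>
            if x 0 = x₀ 0 ∧ (x₀ 1 - j').val < (x 1 - j').val then (x 1 - j').val - (x₀ 1 - j').val
            else if (x 1 - j').val = L - 1 then L + (x₀ 0 - x 0).val
            else 2 * L + (L - 1 - (x 1 - j').val)) q = 2 * L + (L - 1 - (q 1 - j').val) := by
          simp only [if_neg hA, if_neg hB]
        have hyb : ((q.shift 1) 1 - j').val = (q 1 - j').val + 1 := hb_up q hB
        have hy0 : (q.shift 1) 0 = q 0 := (shift_one_apply q).1
        have hnot_s : q.shift 1 ∉ s := by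
          intro hy
          have hm := hmin _ hy
          simp only [hrank_q] at hm
          rw [hy0, hyb] at hm
          have hvq := hvalL (q 1 - j')
          by_cases h1 : q 0 = x₀ 0 ∧ (x₀ 1 - j').val < (q 1 - j').val + 1
          · rw [if_pos h1] at hm
            omega
          · rw [if_neg h1] at hm
            by_cases h2 : (q 1 - j').val + 1 = L - 1
            · rw [if_pos h2] at hm
              have := hvalL (x₀ 0 - q 0)
              omega
            · rw [if_neg h2] at hm
              omega
        have hnot_reg : q.shift 1 ∉
            (range R ×ˢ range T).image (fun q : ℕ × ℕ => (![i' + q.1, j' + q.2] : Site 2 L)) := by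
          intro hp
          have hp' := (hmem _).mp hp
          rw [hy0, hyb] at hp'
          exact hq ⟨hp'.1, by omega⟩
        refine integral_mul_prod_insert_peel_inv hv hΦ hqs ((q.shift 1, 0) : Edge 2 L)
          (A := fun U => U (q, 0) * U (q.shift 0, 1)) (B := fun U => (U (q, 1))⁻¹) ((hev _).mul (hev _))
          (hev _).inv (fun U g => ?_) (fun U g => ?_) (fun U => rfl)
          (fun U g => hΦe _ U g fun p hp => ⟨?_, ?_, ?_, ?_⟩) (fun x hx U g => ?_)
        · show update U (q.shift 1, 0) g (q, 0) * update U (q.shift 1, 0) g (q.shift 0, 1) = _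
          rw [update_of_ne (fun h => shift_ne_self hL q 1 (congrArg Prod.fst h).symm),
            update_of_ne (fun h => h01.symm (congrArg Prod.snd h))]
        · exact congrArg _ (update_of_ne (fun h => h01.symm (congrArg Prod.snd h)) _ _)
        · exact fun h => hnot_reg (by
            have h' : p = q.shift 1 := congrArg Prod.fst h
            exact h' ▸ hp)
        · exact fun h => h01.symm (congrArg Prod.snd h)
        · exact fun h => (hins q (mem_insert_self q s)) (by
            have h' : p = q := add_right_cancel (congrArg Prod.fst h :)
            exact h' ▸ hp)
        · exact fun h => h01.symm (congrArg Prod.snd h)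
        · exact plaquetteHolonomy_update_horiz g (fun h => hnot_s (h ▸ hx))
            (fun h => hqs ((add_right_cancel h : x = q) ▸ hx))

end Punctured

/-! ## §4. The loop along the region's boundary ignores every link outside the region -/

section Loop

omit [NeZero L] [TopologicalSpace G] [IsTopologicalGroup G] [CompactSpace G] [SecondCountableTopology G]
  [MeasurableSpace G] [BorelSpace G] in
/-- The `R × T` loop with corner `(i', j')` (`1 ≤ R`, `1 ≤ T`) only uses links of the plaquettes of its
region `{(i'+a, j'+b) : a < R, b < T}`: a link that belongs to none of them does not affect the loop. -/
theorem rectangleHolonomy_update_eq_of_forall_rect {U : GaugeConfig 2 L G} (i' j' : ZMod L) {R T : ℕ}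
    (hR1 : 1 ≤ R) (hT1 : 1 ≤ T) {e : Edge 2 L} (g : G)
    (he : ∀ p ∈ (range R ×ˢ range T).image (fun q : ℕ × ℕ => (![i' + q.1, j' + q.2] : Site 2 L)),
      ((p, 0) : Edge 2 L) ≠ e ∧ ((Site.shift p 0, 1) : Edge 2 L) ≠ e ∧
        ((Site.shift p 1, 0) : Edge 2 L) ≠ e ∧ ((p, 1) : Edge 2 L) ≠ e) :
    rectangleHolonomy (update U e g) ![i', j'] 0 1 R T = rectangleHolonomy U ![i', j'] 0 1 R T := by
  have hmem : ∀ a b : ℕ, a < R → b < T →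
      (![i' + a, j' + b] : Site 2 L) ∈
        (range R ×ˢ range T).image (fun q : ℕ × ℕ => (![i' + q.1, j' + q.2] : Site 2 L)) :=
    fun a b ha hb => mem_rect i' j' ha hb
  rw [rectangleHolonomy_vec2, rectangleHolonomy_vec2]
  have hbot : lineHolonomy (update U e g) 0 R ![i', j'] = lineHolonomy U 0 R ![i', j'] :=
    lineHolonomy_congr 0 R _ fun s hs => by
      rw [vec2_add_single_zero]
      have h := (he _ (hmem s 0 hs (by omega))).1
      simp only [Nat.cast_zero, add_zero] at h
      exact update_of_ne h _ _
  have hright : lineHolonomy (update U e g) 1 T ![i' + R, j'] = lineHolonomy U 1 T ![i' + R, j'] :=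
    lineHolonomy_congr 1 T _ fun s hs => by
      rw [vec2_add_single_one]
      have h := (he _ (hmem (R - 1) s (by omega) hs)).2.1
      rw [shift_vec2_zero, show (i' : ZMod L) + ((R - 1 : ℕ) : ZMod L) + 1 = i' + (R : ZMod L) by
        rw [Nat.cast_sub hR1]; push_cast; ring] at h
      exact update_of_ne h _ _
  have htop : lineHolonomy (update U e g) 0 R ![i', j' + T] = lineHolonomy U 0 R ![i', j' + T] :=
    lineHolonomy_congr 0 R _ fun s hs => by
      rw [vec2_add_single_zero]
      have h := (he _ (hmem s (T - 1) hs (by omega))).2.2.1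
      rw [shift_vec2_one, show (j' : ZMod L) + ((T - 1 : ℕ) : ZMod L) + 1 = j' + (T : ZMod L) by
        rw [Nat.cast_sub hT1]; push_cast; ring] at h
      exact update_of_ne h _ _
  have hleft : lineHolonomy (update U e g) 1 T ![i', j'] = lineHolonomy U 1 T ![i', j'] :=
    lineHolonomy_congr 1 T _ fun s hs => by
      rw [vec2_add_single_one]
      have h := (he _ (hmem 0 s (by omega) hs)).2.2.2
      simp only [Nat.cast_zero, add_zero] at h
      exact update_of_ne h _ _
  rw [hbot, hright, htop, hleft]

/-- **The torus analogue of the interior area law, exact off one puncture**: for every compact gauge group,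
continuous representation `ρ`, continuous class weight `w` on the region and continuous weight `v` on a finite
set `t` of outside plaquettes missing the puncture `x₀`,
`∫ ρ(W_{R×T})_{ab} ∏_{p∈Reg} w(U_p) ∏_{x∈t} v(U_x) dHaar^{⊗E} = (∫ v)^{#t} · (M_w^{RT})_{ab}`
(`1 ≤ R`, `1 ≤ T`, `R + 1 ≤ L`, `T + 1 ≤ L`). -/
theorem integral_rep_loop_mul_prod_punctured (hL : 2 ≤ L) {N : ℕ} (ρ : G →* Matrix (Fin N) (Fin N) ℂ)
    (hρ : Continuous ρ) {w : G → ℝ} (hw : Continuous w) (hwc : ∀ k g, w (k * g * k⁻¹) = w g)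
    {v : G → ℝ} (hv : Continuous v) (i' j' : ZMod L) {R T : ℕ} (hR1 : 1 ≤ R) (hT1 : 1 ≤ T)
    (hR : R + 1 ≤ L) (hT : T + 1 ≤ L) (x₀ : Site 2 L)
    (hx₀ : x₀ ∉ (range R ×ˢ range T).image (fun q : ℕ × ℕ => (![i' + q.1, j' + q.2] : Site 2 L)))
    (t : Finset (Site 2 L))
    (ht : ∀ x ∈ t, x ∉ (range R ×ˢ range T).image (fun q : ℕ × ℕ => (![i' + q.1, j' + q.2] : Site 2 L)))
    (hx₀t : x₀ ∉ t) (a b : Fin N) :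
    ∫ U, ρ (rectangleHolonomy U ![i', j'] 0 1 R T) a b *
        (∏ p ∈ (range R ×ˢ range T).image (fun q : ℕ × ℕ => (![i' + q.1, j' + q.2] : Site 2 L)),
          (w (plaquetteHolonomy U p 0 1) : ℂ)) *
        ∏ x ∈ t, (v (plaquetteHolonomy U x 0 1) : ℂ) ∂(Measure.pi fun _ : Edge 2 L => haarProbability G) =
      (∫ g, (v g : ℂ) ∂(haarProbability G)) ^ t.card *
        ((Matrix.of fun k l : Fin N => ∫ g, ρ g k l * (w g : ℂ) ∂(haarProbability G)) ^ (R * T)) a b := by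
  have hΦ : Continuous fun U : GaugeConfig 2 L G => ρ (rectangleHolonomy U ![i', j'] 0 1 R T) a b *
      ∏ p ∈ (range R ×ˢ range T).image (fun q : ℕ × ℕ => (![i' + q.1, j' + q.2] : Site 2 L)),
        (w (plaquetteHolonomy U p 0 1) : ℂ) :=
    ((hρ.comp (continuous_config_rectangleHolonomy _ 0 1 R T)).matrix_elem a b).mul
      (continuous_finsetProd _ fun p _ =>
        Complex.continuous_ofReal.comp (hw.comp (continuous_config_plaquetteHolonomy p 0 1)))
  rw [integral_mul_prod_punctured_eq hL i' j' hR hT x₀ hx₀ hv hΦ (fun e U g he => ?_) t ht hx₀t,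
    integral_rep_rectangleHolonomy_mul_prod_weight ρ hρ hw hwc i' j' hT hR]
  show ρ (rectangleHolonomy (update U e g) ![i', j'] 0 1 R T) a b * _ =
    ρ (rectangleHolonomy U ![i', j'] 0 1 R T) a b * _
  rw [rectangleHolonomy_update_eq_of_forall_rect i' j' hR1 hT1 g he]
  congr 1
  exact Finset.prod_congr rfl fun p hp => by
    obtain ⟨h1, h2, h3, h4⟩ := he p hp
    rw [plaquetteHolonomy_update_of_ne g h1 h2 h3 h4]

end Loop

end Summit.Ventures.LatticeQCDFlow.Scoring
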